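import Summits.MatrixMultiplication.MatrixMultiplication.Theorems.SaturationLadderUniformWindowRung
import Summits.MatrixMultiplication.MatrixMultiplication.Theorems.SaturationLadderSixFifthsWindow
import HarnessLib

/-!
# SaturationLadder — Kernel XXVI (ii): the first visible uniform rung `U(6/5)`

Support for the deciding crux `SubexpSaturation` (h₁, item 25909) of `Theses/SaturationLadder.lean`
(cell `decomp-mm`, lens «grading / quantitative ladder», gen 54).  No new hypotheses, no `sorry`.

THE RUNG.  **For every `t ∈ [0,1)` some `r ∈ [1, e^{1.2/(1−t)}]` has `ω(1, t, r) = 1 + r`**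
(`uniformClause_six_fifths`); equivalently **`Δ(r) = (1 − τ_ℂ(r))·log r ≤ 6/5` for every
`r ≥ 1`** (`frontierDefect_le_six_fifths`: the tight abscissa of `⟨1, ·, r⟩` is within
`1.2/log r` of `1`), and `Δ(r) ≤ 11/10` for every `r ≥ e^{46}` (`frontierDefect_le_eleven_tenths`;
Kernel XXV-A had the `11/10` bound only beyond `e^{704}`).  The ladder so far:
`U(log 4) ≈ U(1.3863)` (Kernel XXIV = level 1 of Coppersmith–Winograd, uniformly),
`U(log 4 − 1/12800)` (Kernel XXV-B, an invisible gain), `U(log 4 − 1/20)` conditional on 22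
uncertified twin values (Kernel XXV-C).
`6/5` is the first rate visibly below the level-1 constant — a `13 %` cut, uniform in `t`,
certified end to end by the kernel; also `U(log 4 − (1 − t₆₄)/20)` from the price list
`uniformClause_of_familyY` now instantiated at `j₀ = 64` (`uniformClause_familyY_sixtyFour`).
`SubexpSaturation` itself is `∀ c > 0`, the clause at rate `c` eventually; the uniform rungs
`U(C)`, `C ↓`, are this lens's graded currency toward it (`Δ(r) → 0` being the crux).

THE PROOF is the window argument `uniformClause_of_window` (Kernel XXV-A) with
* ONSET `t₆₄ = 24832/25441 ≈ 0.97606`: the twin family is tight from `j = 64` on (`familyX`,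
  `familyY64`), so the clause at rate `11/10 ≤ 6/5` holds on `[t₆₄, 1)`
  (`twinClause_eleven_tenths`);
* WINDOW `[0, t₆₄)`: `[0, 1/2]` by the level-1 segment `firstSegment` (rate `11/10`), `[1/2, t₆₄]`
  by the thirteen certified chord pieces of `Theorems/SaturationLadderSixFifthsWindow.lean`
  (`cover_mid`) through the certified twin table `Theorems/SaturationLadderTwinTable.lean`.
Why `6/5` and not less with these vertices: the chord `(1/2, 9/2) → twin₅` alone peaks at
`(1−t) log r(t) ≈ 1.152` and the family point has defect `1.068`; a finer table (twins at every
`j ≲ 240`, a lower family threshold is not available) would reach `≈ 1.16` — the CW level-2 value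
`1.178…` is no barrier in this currency, but `≈ 1.15` is the floor of chords through twin points.

References: D. Coppersmith, S. Winograd, J. Symbolic Comput. 9 (1990) §§6–8 (key
`CoppersmithWinograd1990`); G. Lotti, F. Romani, Theoret. Comput. Sci. 23 (1983) 171–185 (key
`LottiRomani1983`); J. Alman, R. Duan, V. Vassilevska Williams, Y. Xu, Z. Xu, R. Zhou, SODA 2025,
§3.4 (key `AlmanDuanVassilevskaWilliamsXuXuZhou2025`).
-/

set_option linter.dupNamespace false
-- (single-conjunct summit: the namespace repeats `MatrixMultiplication`)

noncomputable section

namespace Summit.MatrixMultiplication.MatrixMultiplication.Theorems.SaturationLadderUniformSixFifths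

open Literature.Computability.AlgebraicComplexity
open Summit.MatrixMultiplication.MatrixMultiplication.Theorems.SaturationLadderTwinFamily
open Summit.MatrixMultiplication.MatrixMultiplication.Theorems.SaturationLadderTwinFamilyY64
  (familyY64)
open Summit.MatrixMultiplication.MatrixMultiplication.Theorems.SaturationLadderSixFifthsWindow
  (fT_sixtyFour cover_mid)
open Summit.MatrixMultiplication.MatrixMultiplication.Theorems.SaturationLadderUniformCorners
  (log_four_gt)
open Summit.MatrixMultiplication.MatrixMultiplication.Theorems.SaturationLadderUniformDefect
  (uniformClause_mono uniformClause_iff_defect)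
open Summit.MatrixMultiplication.MatrixMultiplication.Theorems.SaturationLadderUniformWindow
  (uniformClause_of_window defect_le_beyond_onset twinClause_eleven_tenths)
open Summit.MatrixMultiplication.MatrixMultiplication.Theorems.SaturationLadderUniformWindowRung
  (firstSegment uniformClause_of_familyY)

/-- **The twin clause at rate `11/10` from the onset `t₆₄` (unconditional).**
[cite: CoppersmithWinograd1990, §8] [cite: AlmanDuanVassilevskaWilliamsXuXuZhou2025, §3.4] -/
theorem twinClause_eleven_tenths_sixtyFour : ∀ t : ℝ, fT 64 ≤ t → t < 1 →
    ∃ r : ℝ, 1 ≤ r ∧ r ≤ Real.exp (1.1 / (1 - t)) ∧ omegaRect ℂ 1 t r ≤ 1 + r :=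
  twinClause_eleven_tenths 64 le_rfl fun j hj => familyY64 j hj

/-- **The window `[0, t₆₄)` at rate `6/5`.** [cite: LottiRomani1983, §1 (p. 173)] -/
theorem window_six_fifths : ∀ t : ℝ, 0 ≤ t → t < fT 64 →
    ∃ r : ℝ, 1 ≤ r ∧ r ≤ Real.exp ((6 / 5) / (1 - t)) ∧ omegaRect ℂ 1 t r ≤ 1 + r := by
  intro t ht0 ht1
  rw [fT_sixtyFour] at ht1
  rcases le_or_gt t (1 / 2) with h | h
  · obtain ⟨r, h1, h2, h3⟩ := firstSegment t ht0 h
    have h1t : 0 < 1 - t := by linarith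
    exact ⟨r, h1, h2.trans (Real.exp_le_exp.2 (div_le_div_of_nonneg_right (by norm_num) h1t.le)),
      h3⟩
  · exact cover_mid t h.le ht1.le

/-- **KERNEL XXVI — THE UNIFORM RUNG `U(6/5)`.**  For every `t ∈ [0, 1)` some
`r ∈ [1, e^{(6/5)/(1−t)}]` has `ω(1, t, r) ≤ 1 + r` (hence `= 1 + r`).
[cite: CoppersmithWinograd1990, §8] [cite: LottiRomani1983, §1 (p. 173)]
[cite: AlmanDuanVassilevskaWilliamsXuXuZhou2025, §3.4] -/
theorem uniformClause_six_fifths :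
    ∀ t : ℝ, 0 ≤ t → t < 1 → ∃ r : ℝ, 1 ≤ r ∧
      r ≤ Real.exp ((6 / 5) / (1 - t)) ∧ omegaRect ℂ 1 t r ≤ 1 + r :=
  uniformClause_of_window (c := 1.1) (by norm_num) twinClause_eleven_tenths_sixtyFour
    window_six_fifths

/-- **Uniform defect bound `Δ(r) ≤ 6/5`** for every `r ≥ 1`; equivalently `τ_ℂ(r) ≥ 1 − 1.2/log r`
(against `1 − log 4/log r` from the Coppersmith–Winograd level-1 bound). [folklore] -/
theorem frontierDefect_le_six_fifths {r : ℝ} (hr : 1 ≤ r) :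
    (1 - sSup {t : ℝ | omegaRect ℂ 1 t r ≤ 1 + r}) * Real.log r ≤ 6 / 5 :=
  (uniformClause_iff_defect (by norm_num)).1 uniformClause_six_fifths r hr

/-- **`Δ(r) ≤ 11/10` for every `r ≥ e^{46}`** (the twin clause from the onset `t₆₄`;
`1.1/(1 − t₆₄) = 1.1·25441/609 < 46`). [folklore] -/
theorem frontierDefect_le_eleven_tenths {r : ℝ} (hr : Real.exp 46 ≤ r) :
    (1 - sSup {t : ℝ | omegaRect ℂ 1 t r ≤ 1 + r}) * Real.log r ≤ 1.1 := by
  refine defect_le_beyond_onset (c := 1.1) (t₀ := fT 64) (by norm_num) (fT_lt_one 64)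
    twinClause_eleven_tenths_sixtyFour r (le_trans ?_ hr)
  rw [fT_sixtyFour]
  exact Real.exp_le_exp.2 (by norm_num)

/-- The price-list rung at `j₀ = 64`: `U(log 4 − (1 − t₆₄)/20)`, `(1 − t₆₄)/20 = 609/508820`
(superseded by `U(6/5)`, recorded for the ledger of rungs). [folklore] -/
theorem uniformClause_familyY_sixtyFour :
    ∀ t : ℝ, 0 ≤ t → t < 1 → ∃ r : ℝ, 1 ≤ r ∧
      r ≤ Real.exp ((Real.log 4 - 609 / 508820) / (1 - t)) ∧ omegaRect ℂ 1 t r ≤ 1 + r := by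
  have h := uniformClause_of_familyY 64 le_rfl fun j hj => familyY64 j hj
  rw [fT_sixtyFour] at h
  norm_num at h ⊢
  exact h

/-- **Some uniform rung at a rate `≤ 6/5` holds**, and `6/5 < log 4 − 0.18`. [folklore] -/
theorem exists_uniformClause_le_six_fifths :
    ∃ C : ℝ, C ≤ 6 / 5 ∧ C < Real.log 4 - 0.18 ∧ ∀ t : ℝ, 0 ≤ t → t < 1 → ∃ r : ℝ, 1 ≤ r ∧
      r ≤ Real.exp (C / (1 - t)) ∧ omegaRect ℂ 1 t r ≤ 1 + r :=
  ⟨6 / 5, le_rfl, by linarith [log_four_gt], uniformClause_six_fifths⟩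

end Summit.MatrixMultiplication.MatrixMultiplication.Theorems.SaturationLadderUniformSixFifths
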